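import Summits.CriticalPhenomena.PercolationContinuityZ3.Theorems.PercNearOneGluingNoHeavyQuantCrossingDerivRevealment
import Summits.CriticalPhenomena.PercolationContinuityZ3.Theorems.PercNearOneGluingNoHeavyQuantOneArmFiniteSizeSharpness
import HarnessLib
/-!
# The near-critical window sharpened by the critical ONE-ARM probability: `(p_c − p)²·(8L+1)^d·θ_L(p_c) ≳ 1`
# whenever the annulus `Λ(L) ↔ ∂Λ(4L)` stops being crossed (Dewan–Muirhead's `η̄₁ ≤ d − 2/ν`, kernel form), and the
# correlation-length reading `(p_c − p)²·(ξ log ξ)^d·θ_ξ(p_c) ≳ 1`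

builds on p205010 (kernel theorem, internal audit signed; external expert review pending) — used ONLY in §3
(`θ_L(p_c) → 0`, through `FiniteSizeSharpness.tendsto_thetaN_criticalProbI`); §1, §2, §4 do not use it.

QUANT lane (`prim-quant`), seat p4 (METHOD: differential inequalities for `θ` near `p_c` — here Russo's formula + the
O'Donnell–Servedio revealment bound + `θ(p_c) = 0`), gen 14; helper file `--supports stmt-CriticalPhenomena-4575`; pure
proofs, no definitions, no sorries.

In print.  V. Dewan, S. Muirhead, PTRF (2022) [arXiv:2102.12123], proof of Thm. 1.10, p. 10: for `p' < p_c` at which the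
box-crossing probability at scale `R` has dropped to `δ/2`, "`(d/dp)P_p[Cross_5(R)] ≥ (δ/2)/(p_c − p')`" at some intermediate
point while Prop. 2.2 gives "`(d/dp)P_p[Cross_5(R)] ≤ cR^{d/2}√(P_{p_c}[A_1(R)])`", "and hence `(p_c − p')² R^d P_{p_c}[A_1(R)] ≥ c`
for large `R`.  By the definition of the exponent `ν`, this implies … `η̄₁ ≤ d − 2/ν`."  Lane 3 of this programme has the
Chayes–Chayes–Fisher–Spencer version WITHOUT the one-arm factor (`Crossing.le_real_boxCrossing_of_window`: the annulus window
`85^{−d} ≤ u_{p_c}(L,4L)` persists while `(p_c − p)²·2d(8L+1)^d ≤ 85^{−d}p(1−p_c)`, and `Crossing.exists_mul_le_sq_mul_pow_corrLength`: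
`c_d p ≤ (p_c − p)²(ξ⁺log(2ξ⁺+1))^d`).  This file multiplies the edge count `2d(8L+1)^d` by `8·θ_L(p_c)`:

* §1 `sqrt_real_boxCrossing_le_oneArm` — for `0 < q ≤ p < 1`, `L ≥ 1`:
  `√u_p(L,4L) ≤ √u_q(L,4L) + (p − q)·√(4d(8L+1)^d·θ_L(p)/(q(1−p)))` (integrating `…QuantCrossingDerivRevealment`).
* §2 **THE ONE-ARM WINDOW** `le_real_boxCrossing_of_window_oneArm` (`d ≥ 2`, `0 < p ≤ p_c`, `L ≥ 1`): if
  `(p_c − p)²·16d(8L+1)^d·θ_L(p_c) ≤ 85^{−d}·p·(1 − p_c)` then still `u_p(L,4L) ≥ 85^{−d}/4`; contrapositive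
  `sq_mul_oneArm_gt_of_real_boxCrossing_lt`: **`u_p(L,4L) < 85^{−d}/4 ⟹ 85^{−d}p(1−p_c) < (p_c − p)²·16d(8L+1)^d·θ_L(p_c)`** —
  Dewan–Muirhead's `(p_c−p')²R^dπ_R(p_c) ≥ c` with explicit constants, every `d ≥ 2`.
* §3 (p205010) `tendsto_window_ratio`: the ratio of the two window conditions is `8θ_L(p_c) → 0` — in every `d ≥ 2` the CCFS
  window is NOT sharp: the crossing window at scale `L` is wider than `c_d L^{−d/2}` by the factor `(8θ_L(p_c))^{−1/2} → ∞`
  (`le_real_boxCrossing_of_eps_window`).  No rate beyond the lane's: §5 `le_real_boxCrossing_of_window_logStar` substitutes the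
  explicit iterated-logarithm bound `θ_L(p_c) ≤ (1 − knEta d)^{iterCount (knLHi d) L}` (`Quant.oneArm_explicit_rate_criticalProbI`,
  V35, `d ≥ 3`) — an explicit function tending to `0` and nothing more.
* (companion file `…QuantCrossingCorrLengthOneArm.lean`, no p205010): the correlation-length form
  `c_d·p ≤ (p_c − p)²·(ξ⁺log(2ξ⁺+1))^d·θ_{⌈ξ⁺⌉}(p_c)` ("`ν ≥ 2/(d − η₁)`"), the (T1) dictionary and the explicit log* window.

Honest placement: §2/§4 are kernel forms (explicit constants, annulus crossings of aspect 4, all `d ≥ 2`) of an inequality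
that is IN PRINT at exponent level (DM22 Thm. 1.10, `η̄₁ ≤ d − 2/ν`, "assuming the existence of the exponents"); §3 is the
`θ(p_c) = 0` reading; nothing here is a rate for `d = 3` (that needs (T1), an upper bound on `θ_L(p_c)` better than log*).
Mean-field check: `L^{−d}θ_L^{−1} = L^{−(d−2)}` vs the true window `L^{−2}` (`ν = 1/2`): not sharp above `d = 4`; `d = 3`:
exponent `(3 − 0.48)/2 = 1.26` vs `1/ν ≈ 1.14` (orientation only).
-/

noncomputable section

namespace Summit.CriticalPhenomena.PercolationContinuityZ3.Theorems.CrossingRevealment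

open MeasureTheory Finset Function Set Filter Topology
open Literature.Probability.Percolation Literature.Probability.LatticeModels
open Literature.Probability.Percolation.DCT16
open Summit.CriticalPhenomena.PercolationContinuityZ3.Theorems.SurfaceTension
open Summit.CriticalPhenomena.PercolationContinuityZ3.Theorems.Crossing

variable {d : ℕ}

/-! ### §1. Integrated form: `√u` is Lipschitz at scale `√(4d(8L+1)^d θ_L)` -/

/-- **Annulus crossings across the window, one-arm form.**  For `d ≥ 1`, `L ≥ 1` and `0 < q ≤ p < 1`:
`√u_p(L,4L) ≤ √u_q(L,4L) + (p − q)·√(4d(8L+1)^d·θ_L(p)/(q(1−p)))`, `u_r(L,4L) = P_r(boxCrossing d L (4L))`,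
`θ_L(p) = P_p(0 ↔ ∂Λ_L)`.  (Lane 3's `Crossing.sqrt_real_boxCrossing_le` has `2d(8L+1)^d` without the factor `8θ_L(p)`.)
[cite: DewanMuirhead2022, Prop. 2.2 and proof of Thm. 1.10 (integrating the derivative bound between p' and p_c)] -/
theorem sqrt_real_boxCrossing_le_oneArm (hd : 1 ≤ d) {L : ℕ} (hL : 1 ≤ L) (q p : unitInterval) (hq : 0 < (q : ℝ))
    (hqp : (q : ℝ) ≤ p) (hp : (p : ℝ) < 1) :
    Real.sqrt ((bondPercolation (zdGraph d) p).real (boxCrossing d L (4 * L))) ≤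
      Real.sqrt ((bondPercolation (zdGraph d) q).real (boxCrossing d L (4 * L))) +
        Real.sqrt (4 * d * (8 * (L : ℝ) + 1) ^ d * (bondPercolation (zdGraph d) p).real (siteToBoundary d L)
          / ((q : ℝ) * (1 - p))) * ((p : ℝ) - q) := by
  classical
  set g : ℝ → ℝ := fun r => (bondPercolation (zdGraph d) (projIcc 0 1 zero_le_one r)).real (boxCrossing d L (4 * L))
    with hg
  set θL : ℝ := (bondPercolation (zdGraph d) p).real (siteToBoundary d L) with hθL
  set C : ℝ := 4 * d * (8 * (L : ℝ) + 1) ^ d with hC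
  set K : ℝ := C * θL / ((q : ℝ) * (1 - p)) with hK
  have hqp' : 0 < (q : ℝ) * (1 - p) := mul_pos hq (by linarith)
  have hC0 : 0 ≤ C := by positivity
  have hθL0 : 0 ≤ θL := measureReal_nonneg
  have hK0 : 0 ≤ K := div_nonneg (mul_nonneg hC0 hθL0) hqp'.le
  have hF : DeterminedBy (boxCrossing d L (4 * L)) (↑(edgesIn (zdGraph d) (box d (4 * L))) : Set (Sym2 (Site d))) := by
    rw [boxCrossing_eq_linked]; exact determinedBy_linked_edgesIn _ _ _
  have hcont : Continuous g := (continuous_bondPercolation_real_of_determinedBy (zdGraph d) hF).comp continuous_projIcc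
  have hg0 : ∀ x ∈ Icc (q : ℝ) p, 0 ≤ g x := fun x _ => measureReal_nonneg
  have hpe : projIcc 0 1 zero_le_one (p : ℝ) = p := projIcc_val zero_le_one p
  have hqe : projIcc 0 1 zero_le_one (q : ℝ) = q := projIcc_val zero_le_one q
  have hmain := ThetaModulus.sqrt_le_sqrt_add_of_deriv_le hqp (by positivity : (0 : ℝ) ≤ 2 * Real.sqrt K)
    hcont.continuousOn hg0 ?_
  · have e1 : g p = (bondPercolation (zdGraph d) p).real (boxCrossing d L (4 * L)) := by simp only [hg, hpe]
    have e2 : g q = (bondPercolation (zdGraph d) q).real (boxCrossing d L (4 * L)) := by simp only [hg, hqe]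
    rw [e1, e2] at hmain
    calc _ ≤ _ := hmain
      _ = _ := by rw [hK, hC, hθL]; ring
  -- the derivative bound on `(q, p)`
  intro r hr
  have hr01 : r ∈ Ioo (0 : ℝ) 1 := ⟨hq.trans hr.1, hr.2.trans hp⟩
  have hLM : L ≤ 2 * L := by omega
  have hMN : 2 * L + 1 ≤ 4 * L := by omega
  obtain ⟨D, hD, _, hDle⟩ := hasDerivAt_real_boxCrossing_le hd hLM hMN hr01
  refine ⟨D, hD, hDle.trans ?_⟩
  set u : ℝ := (bondPercolation (zdGraph d) (projIcc 0 1 zero_le_one r)).real (boxCrossing d L (4 * L)) with hu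
  have hu0 : 0 ≤ u := measureReal_nonneg
  have hu1 : u ≤ 1 := measureReal_le_one
  -- `θ_m(r) ≤ θ_L(r) ≤ θ_L(p)`
  have hrI : r ∈ Icc (0 : ℝ) 1 := ⟨hr01.1.le, hr01.2.le⟩
  have hθ1 : thetaN d (min (4 * L - 2 * L - 1) (2 * L + 1 - L)) r ≤ thetaN d L r := by
    unfold thetaN
    exact real_siteToBoundary_antitone _ (le_min (by omega) (by omega))
  have hθ2 : thetaN d L r ≤ θL := by
    have h := DKT20.thetaN_mono d L hr.2.le
    rwa [thetaN, thetaN, hpe] at h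
  have hθm0 : 0 ≤ thetaN d (min (4 * L - 2 * L - 1) (2 * L + 1 - L)) r := (thetaN_mem_Icc d _ r).1
  have hcast : (4 * d * (2 * ((4 * L : ℕ) : ℝ) + 1) ^ d : ℝ) = C := by rw [hC]; push_cast; ring
  rw [hcast]
  have hrr : (q : ℝ) * (1 - p) ≤ r * (1 - r) := by nlinarith [hr.1, hr.2]
  have hrr0 : 0 < r * (1 - r) := hqp'.trans_le hrr
  -- compare the radicands
  have hnum : u * (1 - u) * C * thetaN d (min (4 * L - 2 * L - 1) (2 * L + 1 - L)) r ≤ u * C * θL := by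
    have h1 : (1 - u) * thetaN d (min (4 * L - 2 * L - 1) (2 * L + 1 - L)) r ≤ 1 * θL :=
      mul_le_mul (by linarith) (hθ1.trans hθ2) hθm0 zero_le_one
    have h2 := mul_le_mul_of_nonneg_left h1 (mul_nonneg hu0 hC0)
    calc u * (1 - u) * C * thetaN d (min (4 * L - 2 * L - 1) (2 * L + 1 - L)) r
        = u * C * ((1 - u) * thetaN d (min (4 * L - 2 * L - 1) (2 * L + 1 - L)) r) := by ring
      _ ≤ u * C * (1 * θL) := h2
      _ = u * C * θL := by ring
  have hrad : u * (1 - u) * C * thetaN d (min (4 * L - 2 * L - 1) (2 * L + 1 - L)) r / (r * (1 - r))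
      ≤ K * u := by
    calc _ ≤ u * (1 - u) * C * thetaN d (min (4 * L - 2 * L - 1) (2 * L + 1 - L)) r / ((q : ℝ) * (1 - p)) :=
          div_le_div_of_nonneg_left (mul_nonneg (mul_nonneg (mul_nonneg hu0 (by linarith)) hC0) hθm0) hqp' hrr
      _ ≤ u * C * θL / ((q : ℝ) * (1 - p)) := div_le_div_of_nonneg_right hnum hqp'.le
      _ = K * u := by rw [hK]; ring
  calc 2 * Real.sqrt (u * (1 - u) * C * thetaN d (min (4 * L - 2 * L - 1) (2 * L + 1 - L)) r / (r * (1 - r)))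
      ≤ 2 * Real.sqrt (K * u) := mul_le_mul_of_nonneg_left (Real.sqrt_le_sqrt hrad) (by norm_num)
    _ = 2 * Real.sqrt K * Real.sqrt u := by rw [Real.sqrt_mul hK0]; ring

/-! ### §2. THE ONE-ARM WINDOW at `p_c` -/

/-- **THE ONE-ARM-SHARPENED CRITICAL WINDOW.**  For `d ≥ 2`, `0 < p ≤ p_c(ℤ^d)` and `L ≥ 1`: if
`(p_c − p)² · 16d(8L+1)^d · θ_L(p_c) ≤ 85^{−d} · p · (1 − p_c)` then `P_p(Λ(L) ↔ ∂ⁱⁿΛ(4L) in Λ(4L)) ≥ 85^{−d}/4`.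
Compared with the Chayes–Chayes–Fisher–Spencer window of lane 3 (`Crossing.le_real_boxCrossing_of_window`, hypothesis
`(p_c − p)²·2d(8L+1)^d ≤ 85^{−d}p(1−p_c)`) the edge count is multiplied by `8θ_L(p_c)`.  Proof: the tree's window
`85^{−d} ≤ u_{p_c}(L,4L)` (`SurfaceTension.le_crossProb_criticalProbI`) and §1 between `p` and `p_c`.
[cite: DewanMuirhead2022, §2 proof of Thm. 1.10 ((p_c − p')² R^d P_{p_c}[A_1(R)] ≥ c)] [cite: Kesten1982, Cor. 5.1] -/
theorem le_real_boxCrossing_of_window_oneArm (hd : 2 ≤ d) (p : unitInterval) (hp0 : 0 < (p : ℝ))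
    (hpc : (p : ℝ) ≤ criticalProbI d) {L : ℕ} (hL : 1 ≤ L)
    (hwin : ((criticalProbI d : ℝ) - p) ^ 2 * (16 * d * (8 * (L : ℝ) + 1) ^ d
        * (bondPercolation (zdGraph d) (criticalProbI d)).real (siteToBoundary d L)) ≤
      ((85 : ℝ) ^ d)⁻¹ * p * (1 - criticalProbI d)) :
    ((85 : ℝ) ^ d)⁻¹ / 4 ≤ (bondPercolation (zdGraph d) p).real (boxCrossing d L (4 * L)) := by
  have hpc1 : (criticalProbI d : ℝ) < 1 := by rw [coe_criticalProbI]; exact criticalProb_zd_lt_one hd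
  set c : ℝ := ((85 : ℝ) ^ d)⁻¹ with hc
  have hc0 : 0 < c := by positivity
  set θL : ℝ := (bondPercolation (zdGraph d) (criticalProbI d)).real (siteToBoundary d L) with hθL
  have hθL0 : 0 ≤ θL := measureReal_nonneg
  -- the window at `p_c`
  have hcrit : c ≤ (bondPercolation (zdGraph d) (criticalProbI d)).real (boxCrossing d L (4 * L)) :=
    le_crossProb_criticalProbI hd hL
  -- §1 between `p` and `p_c`
  have h1 := sqrt_real_boxCrossing_le_oneArm (d := d) (by omega) hL p (criticalProbI d) hp0 hpc hpc1
  set u := (bondPercolation (zdGraph d) p).real (boxCrossing d L (4 * L)) with hu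
  set m : ℝ := 4 * d * (8 * (L : ℝ) + 1) ^ d * θL with hm
  have hm0 : 0 ≤ m := by positivity
  have hden : 0 < (p : ℝ) * (1 - criticalProbI d) := mul_pos hp0 (by linarith)
  by_contra hlt
  push Not at hlt
  have hu0 : 0 ≤ u := measureReal_nonneg
  have hsu : Real.sqrt u < Real.sqrt c / 2 := by
    have h4 : Real.sqrt (c / 4) = Real.sqrt c / 2 := by
      rw [Real.sqrt_div' c (by norm_num : (0 : ℝ) ≤ 4), show (4 : ℝ) = 2 ^ 2 by norm_num,
        Real.sqrt_sq (by norm_num : (0 : ℝ) ≤ 2)]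
    rw [← h4]
    exact Real.sqrt_lt_sqrt hu0 hlt
  have hsc : Real.sqrt c ≤ Real.sqrt ((bondPercolation (zdGraph d) (criticalProbI d)).real (boxCrossing d L (4 * L))) :=
    Real.sqrt_le_sqrt hcrit
  set S := Real.sqrt (m / ((p : ℝ) * (1 - criticalProbI d))) with hS
  have hS0 : 0 ≤ S := Real.sqrt_nonneg _
  have hkey : Real.sqrt c / 2 < S * ((criticalProbI d : ℝ) - p) := by
    have : Real.sqrt ((bondPercolation (zdGraph d) (criticalProbI d)).real (boxCrossing d L (4 * L)))
        ≤ Real.sqrt u + S * ((criticalProbI d : ℝ) - p) := by rw [hS, hm, hθL]; exact h1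
    linarith
  have hsqc : 0 < Real.sqrt c := Real.sqrt_pos.2 hc0
  have hδ : 0 < (criticalProbI d : ℝ) - p := by
    by_contra h
    push Not at h
    have : S * ((criticalProbI d : ℝ) - p) ≤ 0 := mul_nonpos_of_nonneg_of_nonpos hS0 h
    linarith
  -- square: `c/4 < (p_c − p)² · m/(p(1−p_c))`
  have hsq : c / 4 < ((criticalProbI d : ℝ) - p) ^ 2 * (m / ((p : ℝ) * (1 - criticalProbI d))) := by
    have h2 : (Real.sqrt c / 2) ^ 2 < (S * ((criticalProbI d : ℝ) - p)) ^ 2 :=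
      pow_lt_pow_left₀ hkey (by positivity) two_ne_zero
    rw [div_pow, Real.sq_sqrt hc0.le, mul_pow, Real.sq_sqrt (div_nonneg hm0 hden.le)] at h2
    linarith
  have hsq' : c * ((p : ℝ) * (1 - criticalProbI d)) < ((criticalProbI d : ℝ) - p) ^ 2 * (4 * m) := by
    have := mul_lt_mul_of_pos_right hsq hden
    rw [mul_assoc, div_mul_cancel₀ _ hden.ne'] at this
    linarith
  have h4m : 4 * m = 16 * d * (8 * (L : ℝ) + 1) ^ d * θL := by rw [hm]; ring
  rw [h4m] at hsq'
  have : ((criticalProbI d : ℝ) - p) ^ 2 * (16 * d * (8 * (L : ℝ) + 1) ^ d * θL) ≤ c * ((p : ℝ) * (1 - criticalProbI d)) :=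
    calc _ ≤ c * p * (1 - criticalProbI d) := hwin
      _ = c * ((p : ℝ) * (1 - criticalProbI d)) := by ring
  linarith

/-- **Contrapositive (Dewan–Muirhead's inequality with explicit constants).**  For `d ≥ 2`, `0 < p ≤ p_c`, `L ≥ 1`: if the
annulus `Λ(L) ↔ ∂ⁱⁿΛ(4L)` is crossed with probability `< 85^{−d}/4` at `p`, then
**`85^{−d}·p·(1 − p_c) < (p_c − p)² · 16d(8L+1)^d · θ_L(p_c)`** — "`(p_c − p')² R^d P_{p_c}[A_1(R)] ≥ c`".
[cite: DewanMuirhead2022, §2 proof of Thm. 1.10 ((p_c − p')² R^d P_{p_c}[A_1(R)] ≥ c for large R)] -/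
theorem sq_mul_oneArm_gt_of_real_boxCrossing_lt (hd : 2 ≤ d) (p : unitInterval) (hp0 : 0 < (p : ℝ))
    (hpc : (p : ℝ) ≤ criticalProbI d) {L : ℕ} (hL : 1 ≤ L)
    (hsmall : (bondPercolation (zdGraph d) p).real (boxCrossing d L (4 * L)) < ((85 : ℝ) ^ d)⁻¹ / 4) :
    ((85 : ℝ) ^ d)⁻¹ * p * (1 - criticalProbI d) <
      ((criticalProbI d : ℝ) - p) ^ 2 * (16 * d * (8 * (L : ℝ) + 1) ^ d
        * (bondPercolation (zdGraph d) (criticalProbI d)).real (siteToBoundary d L)) := by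
  by_contra h
  push Not at h
  exact (not_le.2 hsmall) (le_real_boxCrossing_of_window_oneArm hd p hp0 hpc hL h)

/-! ### §3. With `θ(p_c) = 0` (p205010): the CCFS window is never sharp -/

/-- **The ratio of the two window conditions tends to zero**: `16d(8L+1)^dθ_L(p_c) / (2d(8L+1)^d) = 8θ_L(p_c) → 0` as
`L → ∞`, every `d ≥ 2` — so the one-arm window of §2 is eventually wider than the Chayes–Chayes–Fisher–Spencer window
`(p_c − p) ≤ c_d L^{−d/2}` by any prescribed factor.  builds on p205010 (kernel theorem, internal audit signed; external expert review
pending): `θ_L(p_c) → 0` is `FiniteSizeSharpness.tendsto_thetaN_criticalProbI`. -/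
theorem tendsto_window_ratio (hd : 2 ≤ d) :
    Tendsto (fun L : ℕ => (16 * d * (8 * (L : ℝ) + 1) ^ d
        * (bondPercolation (zdGraph d) (criticalProbI d)).real (siteToBoundary d L))
          / (2 * d * (8 * (L : ℝ) + 1) ^ d)) atTop (𝓝 0) := by
  have hd' : (0 : ℝ) < d := by exact_mod_cast (show 0 < d by omega)
  have h := (FiniteSizeSharpness.tendsto_thetaN_criticalProbI (d := d) hd).const_mul 8
  rw [mul_zero] at h
  refine h.congr fun L => ?_
  have hpos : (0 : ℝ) < 2 * d * (8 * (L : ℝ) + 1) ^ d := by positivity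
  rw [thetaN_coe]
  field_simp
  ring

/-- **Eventual domination**: for every `ε > 0`, for all large `L`, `16d(8L+1)^dθ_L(p_c) ≤ ε·2d(8L+1)^d`; hence (§2) the
annulus window at scale `L` persists for `(p_c − p)² ≤ 85^{−d}p(1−p_c)/(ε·2d(8L+1)^d)`, a window wider than lane 3's by the
factor `ε^{−1/2}` (`le_real_boxCrossing_of_eps_window`).  builds on p205010 (kernel theorem, internal audit signed; external expert
review pending). -/
theorem eventually_oneArm_coeff_le (hd : 2 ≤ d) {ε : ℝ} (hε : 0 < ε) :
    ∀ᶠ L : ℕ in atTop, 16 * d * (8 * (L : ℝ) + 1) ^ d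
        * (bondPercolation (zdGraph d) (criticalProbI d)).real (siteToBoundary d L)
      ≤ ε * (2 * d * (8 * (L : ℝ) + 1) ^ d) := by
  have hd' : (0 : ℝ) < d := by exact_mod_cast (show 0 < d by omega)
  have h := (tendsto_window_ratio (d := d) hd).eventually (gt_mem_nhds hε)
  filter_upwards [h] with L hL
  have hpos : (0 : ℝ) < 2 * d * (8 * (L : ℝ) + 1) ^ d := by positivity
  exact (div_lt_iff₀ hpos).1 hL |>.le

/-- **The `ε`-window**: for every `ε > 0` and all large `L`, the annulus crossing `u_p(L,4L) ≥ 85^{−d}/4` persists for every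
`0 < p ≤ p_c` with `(p_c − p)²·ε·2d(8L+1)^d ≤ 85^{−d}p(1−p_c)` — CCFS's window enlarged by `ε^{−1/2}`, `ε` arbitrary.
builds on p205010 (kernel theorem, internal audit signed; external expert review pending). -/
theorem le_real_boxCrossing_of_eps_window (hd : 2 ≤ d) {ε : ℝ} (hε : 0 < ε) :
    ∀ᶠ L : ℕ in atTop, ∀ p : unitInterval, 0 < (p : ℝ) → (p : ℝ) ≤ criticalProbI d →
      ((criticalProbI d : ℝ) - p) ^ 2 * (ε * (2 * d * (8 * (L : ℝ) + 1) ^ d)) ≤ ((85 : ℝ) ^ d)⁻¹ * p * (1 - criticalProbI d) →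
        ((85 : ℝ) ^ d)⁻¹ / 4 ≤ (bondPercolation (zdGraph d) p).real (boxCrossing d L (4 * L)) := by
  filter_upwards [eventually_oneArm_coeff_le hd hε, eventually_ge_atTop 1] with L hL hL1 p hp0 hpc hwin
  refine le_real_boxCrossing_of_window_oneArm hd p hp0 hpc hL1 ((mul_le_mul_of_nonneg_left hL (sq_nonneg _)).trans hwin)

end Summit.CriticalPhenomena.PercolationContinuityZ3.Theorems.CrossingRevealment

end
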